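import Literature.RingTheory.MvPolynomial.ConeBezoutCount
import Mathlib.RingTheory.Ideal.MinimalPrime.Localization
import Mathlib.RingTheory.Localization.AtPrime.Basic
import HarnessLib

/-!
# An isolated point of `V(G₁, …, G_k) ⊂ 𝔸ⁿ` is an isolated point of `n` general combinations

Topic `Literature/RingTheory/CompleteIntersection`. Two pieces of commutative algebra used to feed
the interpolation theorem `Literature.RingTheory.CompleteIntersection.exists_totalDegree_le_aeval_eq_of_isolated`
(`BezoutianDuality.lean`) from the hypothesis "`𝔪` is a minimal prime of `(G₁, …, G_k)`":

* `exists_notMem_forall_mul_mem_of_mem_minimalPrimes` — in a Noetherian ring, if `𝔭` is a minimal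
  prime of `I` then `u 𝔭ᴺ ⊆ I` for some `u ∉ 𝔭` and `N` (the `𝔭`-primary component of `I` is
  `𝔭`-primary: localise at `𝔭`, where `√(I A_𝔭) = 𝔭 A_𝔭`, Mathlib's
  `IsLocalization.AtPrime.radical_map_of_mem_minimalPrimes`);
* `exists_reduction_of_mem_minimalPrimes` — **reduction to `n` equations**: over an infinite field
  `K`, if a prime `𝔪` of `K[y₁, …, yₙ]` with `dim K[y]/𝔪 = 0` (a closed point) is a minimal prime of
  `(G₁, …, G_k)` with `deg Gⱼ ≤ eⱼ` (`eⱼ ≥ 1`), then it is a minimal prime of `(H₁, …, Hₙ)` for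
  suitable `K`-linear combinations `Hᵢ` of the `Gⱼ` with `deg Hᵢ ≤ fᵢ`, `fᵢ ≥ 1`, `∑ fᵢ ≤ ∑ eⱼ`
  (`Hᵢ` uses only the `Gⱼ` of degree at most the `i`-th largest `eⱼ`). The proof is the usual
  construction of a system of parameters by prime avoidance (Matsumura, *Commutative Ring Theory*,
  Thm. 14.1 and its proof; Kollár, *Sharp effective Nullstellensatz*, J. AMS 1 (1988), proof of
  Thm. 1.5 for the degree bookkeeping): at each step a general combination of the not yet used
  `Gⱼ` avoids the minimal primes below `𝔪` of the combinations already chosen, whose dimension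
  therefore drops by one (`Literature.RingTheory.MvPolynomial.ringKrullDim_quotient_add_one_of_mem_minimalPrimes_sup_span`),
  and choosing the unused index of largest `eⱼ` makes the construction triangular, so that a prime
  below `𝔪` containing the chosen combinations and the unused `Gⱼ` contains all the `Gⱼ`.

Everything is proved; no definitions, no named facts.

## References

* [Matsumura1987] H. Matsumura, *Commutative Ring Theory*, CUP 1986, Thm. 14.1 (systems of
  parameters by prime avoidance).
* J. Kollár, *Sharp effective Nullstellensatz*, J. Amer. Math. Soc. 1 (1988) 963–975, proof of
  Thm. 1.5 (general combinations of decreasing degrees).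
-/

noncomputable section

open MvPolynomial

namespace Literature.RingTheory.CompleteIntersection

/-! ### The primary component at a minimal prime -/

/-- **A minimal prime is locally the radical**: if `𝔭` is a minimal prime of `I` in a Noetherian
ring then `u 𝔭ᴺ ⊆ I` for some `u ∉ 𝔭` and some `N`. [folklore] -/
theorem exists_notMem_forall_mul_mem_of_mem_minimalPrimes {R : Type*} [CommRing R]
    [IsNoetherianRing R] {I 𝔭 : Ideal R} (h𝔭 : 𝔭 ∈ I.minimalPrimes) :
    ∃ u ∉ 𝔭, ∃ N : ℕ, ∀ x ∈ 𝔭 ^ N, u * x ∈ I := by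
  classical
  haveI h𝔭p : 𝔭.IsPrime := h𝔭.1.1
  set A := Localization.AtPrime 𝔭 with hA
  have hrad : (I.map (algebraMap R A)).radical = 𝔭.map (algebraMap R A) :=
    IsLocalization.AtPrime.radical_map_of_mem_minimalPrimes A 𝔭 I h𝔭
  haveI : IsNoetherianRing A := IsLocalization.isNoetherianRing 𝔭.primeCompl A inferInstance
  obtain ⟨N, hN⟩ := Ideal.exists_radical_pow_le_of_fg (I.map (algebraMap R A))
    (IsNoetherian.noetherian _)
  rw [hrad, ← Ideal.map_pow] at hN
  -- each element of `𝔭^N` is multiplied into `I` by some element outside `𝔭`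
  have hx : ∀ x ∈ 𝔭 ^ N, ∃ u ∉ 𝔭, u * x ∈ I := by
    intro x hx
    have h1 : algebraMap R A x ∈ I.map (algebraMap R A) := hN (Ideal.mem_map_of_mem _ hx)
    obtain ⟨⟨a, s⟩, h2⟩ := (IsLocalization.mem_map_algebraMap_iff 𝔭.primeCompl A).mp h1
    simp only at h2
    rw [← map_mul] at h2
    obtain ⟨c, hc⟩ := (IsLocalization.eq_iff_exists 𝔭.primeCompl A).mp h2
    refine ⟨c * s, fun h => ?_, ?_⟩
    · rcases h𝔭p.mem_or_mem h with h | h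
      · exact c.2 h
      · exact s.2 h
    · have : (c : R) * s * x = c * a := by rw [← hc]; ring
      rw [this]
      exact I.mul_mem_left _ a.2
  -- finite generation of `𝔭^N` gives a uniform multiplier
  obtain ⟨S, hS⟩ := IsNoetherian.noetherian (𝔭 ^ N)
  choose u hu huI using fun s : S => hx s (hS ▸ Ideal.subset_span s.2)
  refine ⟨∏ s, u s, fun h => ?_, N, fun x hx' => ?_⟩
  · obtain ⟨s, -, hs⟩ := (Ideal.IsPrime.prod_mem_iff (p := 𝔭)).mp h
    exact hu s hs
  · rw [← hS] at hx'
    induction hx' using Submodule.span_induction with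
    | mem x hxS =>
      rw [← Finset.prod_erase_mul Finset.univ (fun s => u s) (Finset.mem_univ ⟨x, hxS⟩), mul_assoc]
      exact I.mul_mem_left _ (huI ⟨x, hxS⟩)
    | zero => rw [mul_zero]; exact I.zero_mem
    | add x y _ _ hx hy => rw [mul_add]; exact I.add_mem hx hy
    | smul a x _ hx => rw [smul_eq_mul, mul_left_comm]; exact I.mul_mem_left _ hx

/-! ### Reduction to `n` general combinations -/

section Reduction

variable {K : Type*} [Field K] [Infinite K] {n k : ℕ}

/-- The inductive step of the reduction: `t ≤ n` combinations `H₀, …, H_{t-1}` of the `Gⱼ`, using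
the distinct indices `idx 0, …, idx (t-1)`, with `deg Hₛ ≤ e (idx s)`, such that (i) a prime below
`𝔪` containing the `Hₛ` and the unused `Gⱼ` contains every `Gⱼ`, and (ii) every minimal prime of
`(H₀, …, H_{t-1})` below `𝔪` has dimension `n − t`. [cite: Matsumura1987, Thm. 14.1] -/
theorem exists_partial_reduction (𝔪 : Ideal (MvPolynomial (Fin n) K)) [𝔪.IsPrime]
    (h𝔪 : ringKrullDim (MvPolynomial (Fin n) K ⧸ 𝔪) = 0) (G : Fin k → MvPolynomial (Fin n) K)
    (e : Fin k → ℕ) (hG : ∀ j, (G j).totalDegree ≤ e j)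
    (hmin : 𝔪 ∈ (Ideal.span (Set.range G)).minimalPrimes) :
    ∀ t ≤ n, ∃ (H : Fin t → MvPolynomial (Fin n) K) (idx : Fin t → Fin k),
      Function.Injective idx ∧ (∀ s, H s ∈ Ideal.span (Set.range G)) ∧
      (∀ s, (H s).totalDegree ≤ e (idx s)) ∧
      (∀ P : Ideal (MvPolynomial (Fin n) K), P.IsPrime → P ≤ 𝔪 → (∀ s, H s ∈ P) →
        (∀ j ∉ Set.range idx, G j ∈ P) → ∀ j, G j ∈ P) ∧
      (∀ P ∈ (Ideal.span (Set.range H)).minimalPrimes, P ≤ 𝔪 →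
        ringKrullDim (MvPolynomial (Fin n) K ⧸ P) = (n - t : ℕ)) := by
  classical
  have hGm : Ideal.span (Set.range G) ≤ 𝔪 := hmin.1.2
  intro t
  induction t with
  | zero =>
    intro _
    refine ⟨Fin.elim0, Fin.elim0, fun i => i.elim0, fun s => s.elim0, fun s => s.elim0,
      fun P _ _ _ h j => h j (by simp), fun P hP _ => ?_⟩
    have h0 : Ideal.span (Set.range (Fin.elim0 : Fin 0 → MvPolynomial (Fin n) K)) = ⊥ := by
      rw [Set.range_eq_empty, Ideal.span_empty]
    haveI : (⊥ : Ideal (MvPolynomial (Fin n) K)).IsPrime := Ideal.isPrime_bot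
    rw [h0, Ideal.minimalPrimes_eq_subsingleton_self, Set.mem_singleton_iff] at hP
    rw [hP, Nat.sub_zero]
    exact Literature.RingTheory.MvPolynomial.ringKrullDim_quotient_bot_mvPolynomial
  | succ t ih =>
    intro ht
    obtain ⟨H, idx, hinj, hHG, hdeg, hii, hiii⟩ := ih (Nat.le_of_succ_le ht)
    set I : Ideal (MvPolynomial (Fin n) K) := Ideal.span (Set.range H) with hI
    have hIm : I ≤ 𝔪 := Ideal.span_le.mpr (by rintro _ ⟨s, rfl⟩; exact hGm (hHG s))
    -- the minimal primes of `I` below `𝔪`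
    set M : Set (Ideal (MvPolynomial (Fin n) K)) := {P | P ∈ I.minimalPrimes ∧ P ≤ 𝔪} with hM
    have hMfin : M.Finite :=
      (Ideal.finite_minimalPrimes_of_isNoetherianRing _ I).subset fun P hP => hP.1
    -- none of them is `𝔪`, so each misses some unused `G j`
    have hMne𝔪 : ∀ P ∈ M, P ≠ 𝔪 := by
      rintro P ⟨hP, hP𝔪⟩ rfl
      have h1 := hiii P hP hP𝔪
      rw [h𝔪] at h1
      have : (n - t : ℕ) = 0 := by exact_mod_cast h1.symm
      omega
    have hMmiss : ∀ P ∈ M, ∃ j ∉ Set.range idx, G j ∉ P := by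
      intro P hP
      by_contra hall
      push Not at hall
      haveI : P.IsPrime := hP.1.1.1
      have hall' : ∀ j, G j ∈ P := hii P hP.1.1.1 hP.2 (fun s => hP.1.1.2 (Ideal.subset_span ⟨s, rfl⟩)) hall
      have hGP : Ideal.span (Set.range G) ≤ P := Ideal.span_le.mpr (by rintro _ ⟨j, rfl⟩; exact hall' j)
      exact hMne𝔪 P hP (le_antisymm hP.2 (hmin.2 ⟨hP.1.1.1, hGP⟩ hP.2))
    -- the unused indices, and one of largest degree among them
    set C : Finset (Fin k) := Finset.univ.filter fun j => j ∉ Set.range idx with hC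
    have hCne : C.Nonempty := by
      obtain ⟨P₀, hP₀, hP₀𝔪⟩ := Ideal.exists_minimalPrimes_le hIm
      obtain ⟨j, hj, -⟩ := hMmiss P₀ ⟨hP₀, hP₀𝔪⟩
      exact ⟨j, Finset.mem_filter.mpr ⟨Finset.mem_univ j, hj⟩⟩
    obtain ⟨jm, hjmC, hjmax⟩ := Finset.exists_max_image C e hCne
    have hjm : jm ∉ Set.range idx := (Finset.mem_filter.mp hjmC).2
    -- the combination map and the subspaces to avoid
    set Lc : (Fin k → K) →ₗ[K] MvPolynomial (Fin n) K :=
      { toFun := fun c => ∑ j ∈ C, c j • G j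
        map_add' := fun c c' => by
          simp only [Pi.add_apply, add_smul, Finset.sum_add_distrib]
        map_smul' := fun a c => by
          simp only [Pi.smul_apply, smul_eq_mul, mul_smul, Finset.smul_sum, RingHom.id_apply] } with hLc
    have hLc_apply : ∀ c, Lc c = ∑ j ∈ C, c j • G j := fun c => rfl
    set W0 : Submodule K (Fin k → K) := LinearMap.ker (LinearMap.proj jm) with hW0
    set SW : Finset (Submodule K (Fin k → K)) :=
      insert W0 (hMfin.toFinset.image fun P => (P.restrictScalars K).comap Lc) with hSW
    have havoid : ∀ W ∈ SW, ¬ (⊤ : Submodule K (Fin k → K)) ≤ W := by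
      intro W hW htop
      rcases Finset.mem_insert.mp hW with rfl | hW
      · have : (Pi.single jm 1 : Fin k → K) ∈ W0 := htop Submodule.mem_top
        rw [hW0, LinearMap.mem_ker, LinearMap.proj_apply, Pi.single_eq_same] at this
        exact one_ne_zero this
      · obtain ⟨P, hP, rfl⟩ := Finset.mem_image.mp hW
        rw [Set.Finite.mem_toFinset] at hP
        obtain ⟨j, hj, hGj⟩ := hMmiss P hP
        have hjC : j ∈ C := Finset.mem_filter.mpr ⟨Finset.mem_univ j, hj⟩
        have : (Pi.single j 1 : Fin k → K) ∈ (P.restrictScalars K).comap Lc := htop Submodule.mem_top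
        rw [Submodule.mem_comap, hLc_apply, Submodule.restrictScalars_mem] at this
        simp only [Pi.single_apply, ite_smul, one_smul, zero_smul, Finset.sum_ite_eq', hjC, if_true]
          at this
        exact hGj this
    obtain ⟨c, -, hc⟩ :=
      Literature.RingTheory.MvPolynomial.exists_mem_forall_notMem_of_forall_not_le ⊤ SW havoid
    have hcjm : c jm ≠ 0 := by
      have := hc W0 (Finset.mem_insert_self _ _)
      rwa [hW0, LinearMap.mem_ker, LinearMap.proj_apply] at this
    have hcP : ∀ P ∈ M, Lc c ∉ P := fun P hP h =>
      hc _ (Finset.mem_insert_of_mem (Finset.mem_image.mpr ⟨P, hMfin.mem_toFinset.mpr hP, rfl⟩)) h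
    -- the new data
    refine ⟨Fin.snoc H (Lc c), Fin.snoc idx jm, ?_, ?_, ?_, ?_, ?_⟩
    · -- injectivity
      intro a b hab
      induction a using Fin.lastCases with
      | last =>
        induction b using Fin.lastCases with
        | last => rfl
        | cast b =>
          rw [Fin.snoc_last, Fin.snoc_castSucc] at hab
          exact absurd ⟨b, hab.symm⟩ hjm
      | cast a =>
        induction b using Fin.lastCases with
        | last =>
          rw [Fin.snoc_last, Fin.snoc_castSucc] at hab
          exact absurd ⟨a, hab⟩ hjm
        | cast b =>
          rw [Fin.snoc_castSucc, Fin.snoc_castSucc] at hab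
          rw [hinj hab]
    · -- membership in `(G)`
      intro s
      induction s using Fin.lastCases with
      | last =>
        rw [Fin.snoc_last, hLc_apply]
        exact Submodule.sum_mem _ fun j _ => Submodule.smul_of_tower_mem _ _ (Ideal.subset_span ⟨j, rfl⟩)
      | cast s => rw [Fin.snoc_castSucc]; exact hHG s
    · -- degrees
      intro s
      induction s using Fin.lastCases with
      | last =>
        rw [Fin.snoc_last, Fin.snoc_last, hLc_apply]
        refine totalDegree_finsetSum_le fun j hj => (totalDegree_smul_le _ _).trans ?_
        exact (hG j).trans (hjmax j hj)
      | cast s => rw [Fin.snoc_castSucc, Fin.snoc_castSucc]; exact hdeg s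
    · -- (i) triangularity
      intro P hPp hP𝔪 hHP hGP
      have hrange : Set.range (Fin.snoc idx jm) = insert jm (Set.range idx) := Fin.range_snoc idx jm
      haveI := hPp
      refine hii P hPp hP𝔪 (fun s => by simpa using hHP (Fin.castSucc s)) fun j hj => ?_
      by_cases hjjm : j = jm
      · subst hjjm
        -- `c jm • G jm = Lc c - ∑_{j ∈ C, j ≠ jm} c j • G j ∈ P`
        have hLcP : Lc c ∈ P := by simpa using hHP (Fin.last t)
        have hrest : ∑ j' ∈ C.erase j, c j' • G j' ∈ P := by
          refine Submodule.sum_mem _ fun j' hj' => ?_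
          have hj'C := Finset.mem_of_mem_erase hj'
          have hj'ne : j' ≠ j := Finset.ne_of_mem_erase hj'
          refine Submodule.smul_of_tower_mem _ _ (hGP j' ?_)
          rw [hrange, Set.mem_insert_iff, not_or]
          exact ⟨hj'ne, (Finset.mem_filter.mp hj'C).2⟩
        have hsingle : c j • G j ∈ P := by
          have e1 : c j • G j = Lc c - ∑ j' ∈ C.erase j, c j' • G j' := by
            rw [hLc_apply, ← Finset.add_sum_erase C (fun j' => c j' • G j') hjmC, add_sub_cancel_right]
          rw [e1]
          exact P.sub_mem hLcP hrest
        have e2 : G j = (c j)⁻¹ • (c j • G j) := by rw [smul_smul, inv_mul_cancel₀ hcjm, one_smul]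
        rw [e2]
        exact Submodule.smul_of_tower_mem _ _ hsingle
      · refine hGP j ?_
        rw [hrange, Set.mem_insert_iff, not_or]
        exact ⟨hjjm, hj⟩
    · -- (ii) dimensions
      intro P' hP' hP'𝔪
      have hspan : Ideal.span (Set.range (Fin.snoc H (Lc c))) = I ⊔ Ideal.span {Lc c} := by
        rw [Fin.range_snoc, Ideal.span_insert, sup_comm]
      rw [hspan] at hP'
      haveI hP'p : P'.IsPrime := hP'.1.1
      have hIP' : I ≤ P' := le_sup_left.trans hP'.1.2
      obtain ⟨P, hP, hPP'⟩ := Ideal.exists_minimalPrimes_le hIP'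
      have hPM : P ∈ M := ⟨hP, hPP'.trans hP'𝔪⟩
      haveI hPp : P.IsPrime := hP.1.1
      have hP'min : P' ∈ (P ⊔ Ideal.span {Lc c}).minimalPrimes := by
        refine ⟨⟨hP'p, sup_le hPP' ((Ideal.span_singleton_le_iff_mem _).mpr
          (hP'.1.2 (Ideal.mem_sup_right (Ideal.mem_span_singleton_self _))))⟩, fun Q hQ hQP' => ?_⟩
        refine hP'.2 ⟨hQ.1, sup_le (hP.1.2.trans (le_sup_left.trans hQ.2)) ?_⟩ hQP'
        exact le_sup_right.trans hQ.2
      have hdim := Literature.RingTheory.MvPolynomial.ringKrullDim_quotient_add_one_of_mem_minimalPrimes_sup_span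
        (hcP P hPM) hP'min
      rw [hiii P hP hPM.2] at hdim
      have hnt : ((n - t : ℕ) : WithBot ℕ∞) = ((n - (t + 1) : ℕ) : WithBot ℕ∞) + 1 := by
        rw [← Nat.cast_one (R := WithBot ℕ∞), ← Nat.cast_add]
        congr 1
        omega
      rw [hnt] at hdim
      exact ENat.WithBot.add_one_cancel.mp hdim

/-- **Reduction to `n` equations at an isolated closed point.** Over an infinite field `K`, let `𝔪`
be a prime of `K[y₁, …, yₙ]` with `dim K[y]/𝔪 = 0` which is a minimal prime of `(G₁, …, G_k)`,
`deg Gⱼ ≤ eⱼ`, `eⱼ ≥ 1`. Then `𝔪` is a minimal prime of `(H₁, …, Hₙ)` for some `Hᵢ ∈ (G)` with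
`deg Hᵢ ≤ fᵢ`, `1 ≤ fᵢ` and `∑ fᵢ ≤ ∑ eⱼ` (the `fᵢ` are `n` of the `eⱼ`, with distinct indices).
[cite: Matsumura1987, Thm. 14.1] -/
theorem exists_reduction_of_mem_minimalPrimes (𝔪 : Ideal (MvPolynomial (Fin n) K)) [𝔪.IsPrime]
    (h𝔪 : ringKrullDim (MvPolynomial (Fin n) K ⧸ 𝔪) = 0) (G : Fin k → MvPolynomial (Fin n) K)
    (e : Fin k → ℕ) (he : ∀ j, 1 ≤ e j) (hG : ∀ j, (G j).totalDegree ≤ e j)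
    (hmin : 𝔪 ∈ (Ideal.span (Set.range G)).minimalPrimes) :
    ∃ (H : Fin n → MvPolynomial (Fin n) K) (f : Fin n → ℕ), (∀ i, H i ∈ Ideal.span (Set.range G)) ∧
      (∀ i, 1 ≤ f i) ∧ (∀ i, (H i).totalDegree ≤ f i) ∧ ∑ i, f i ≤ ∑ j, e j ∧
      𝔪 ∈ (Ideal.span (Set.range H)).minimalPrimes := by
  classical
  obtain ⟨H, idx, hinj, hHG, hdeg, -, hiii⟩ := exists_partial_reduction 𝔪 h𝔪 G e hG hmin n le_rfl
  refine ⟨H, fun i => e (idx i), hHG, fun i => he _, hdeg, ?_, ?_⟩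
  · calc ∑ i, e (idx i) = ∑ j ∈ Finset.univ.image idx, e j := by
          rw [Finset.sum_image fun a _ b _ h => hinj h]
      _ ≤ ∑ j, e j := Finset.sum_le_sum_of_subset_of_nonneg (Finset.subset_univ _) fun _ _ _ => Nat.zero_le _
  · have hGm : Ideal.span (Set.range G) ≤ 𝔪 := hmin.1.2
    have hHm : Ideal.span (Set.range H) ≤ 𝔪 := Ideal.span_le.mpr (by rintro _ ⟨s, rfl⟩; exact hGm (hHG s))
    obtain ⟨P, hP, hP𝔪⟩ := Ideal.exists_minimalPrimes_le hHm
    haveI : P.IsPrime := hP.1.1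
    have hdimP : ringKrullDim (MvPolynomial (Fin n) K ⧸ P) = (0 : ℕ) := by
      rw [hiii P hP hP𝔪, Nat.sub_self]
    have hPeq : P = 𝔪 :=
      Literature.RingTheory.MvPolynomial.eq_of_le_of_ringKrullDim_quotient_eq hP𝔪 hdimP
        (by exact_mod_cast h𝔪)
    rwa [hPeq] at hP

end Reduction

end Literature.RingTheory.CompleteIntersection

end
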